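import Literature.Analysis.FluidPDE.CheskidovShvydkoyAssembly
import Literature.Analysis.FluidPDE.TaoClassGlue
import HarnessLib

/-!
# Tao 2021, Prop. 3.1 (i): the pointwise Littlewood–Paley bounds `P_N u = O(AN)`,
# `∇P_N u = O(AN²)` — (3.2), first two claims

Analysis/FluidPDE proof file (theorems only, no named facts), step 5a of the inline programme
for `Literature.Analysis.FluidPDE.tao_quantitative_ess` (Tao 2021, Thm. 1.2).

T. Tao, arXiv:1908.04958v2, Prop. 3.1 (i), p. 8: under (3.1) `‖u‖_{L^∞_t L³_x} ≤ A`,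
"(3.2) `P_N u(t,x) = O(AN)`; `∇P_N u(t,x) = O(AN²)`; `∂ₜP_N u(t,x) = O(A²N³)`", and p. 10: "The
first two claims of (3.2) are immediate from (3.1) and (2.3)" (Bernstein). In the tree Tao's
Littlewood–Paley piece `P_N`, `N = 2^j`, is the homogeneous dyadic block `Δ̇_j` realised on
functions as `FunctionSpaces.blockFn j v = K_j ⋆ v` (`LittlewoodPaleyKernel`,
`LittlewoodPaleyBlockFn`; an immaterial renormalisation of the cut-off). This file proves the
first two claims of (3.2) in that language:

* `exists_eLpNorm_top_fderiv_blockFn_le` — **Bernstein for derivatives of blocks at `L^∞`**: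
  `‖∂_m Δ̇_j v‖_{L^∞} ≤ C 2^j ‖m‖ ‖Δ̇_j v‖_{L^∞}` for `C¹ ∩ L²` fields with bounded derivative
  (the distribution-level multiplier estimate `exists_eLpNormDistrib_lineDeriv_lpBlock_le` at
  `p = ∞`, transferred to functions exactly as the tree's `L²` version
  `exists_eLpNorm_fderiv_blockFn_le`);
* `exists_tao_blockFn_bounds` — for `v ∈ C¹ ∩ L² ∩ L³(ℝ³)` with `‖v‖₃ ≤ A`:
  `‖Δ̇_j v‖_{L^∞} ≤ C 2^j A` (Bernstein `L³ → L^∞` in dimension `3`,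
  `exists_eLpNorm_top_blockFn_le_eLpNorm`) and `‖∂_m Δ̇_j v‖_{L^∞} ≤ C 2^j ‖m‖ · 2^j A`;
* `IsTaoSolutionOn.blockFn_bounds` — the same for every slice `u(t)` of a Tao-class solution
  with `‖u(t)‖₃ ≤ A` (slices are smooth `L²` fields, `isSmoothL2Field_of_sobolev`), i.e. (3.2),
  first two claims, for the solutions of `tao_quantitative_ess`
  (`IsHkClassicalSolutionOn.exists_isTaoSolutionOn`).

The third claim of (3.2) (`∂ₜP_N u = O(A²N³)`, via the projected equation (3.7) and Lemma 2.1)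
and (3.3) are left to the next file.

## Mathlib / tree search

Tree: `FunctionSpaces.exists_eLpNormDistrib_lineDeriv_lpBlock_le` (`LittlewoodPaleyMultiplierProofs`),
`IsDistributionOf.fderiv_blockFn`, `.eLpNormDistrib_eq`, `.eLpNormDistrib_top_lpBlock_eq`,
`IsC1L2Field`, `IsC1L2Field.fderiv_blockFn_apply`, `.of_isSmoothL2Field`,
`exists_eLpNorm_top_blockFn_le_eLpNorm` (`LittlewoodPaleyFields`, `LittlewoodPaleyBlockFn`),
`memLp_top_blockFn` (`LittlewoodPaleyKernel`), `isSmoothL2Field_of_sobolev`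
(`CheskidovShvydkoyAssembly`), `IsTaoSolutionOn.slice`, `.continuousInLpOn_three` (`TaoClassGlue`).
`lean search 'top_fderiv_blockFn|tao_blockFn'`: nothing prior at `p = ∞`.

## References

* T. Tao, *Quantitative bounds for critically bounded solutions to the Navier–Stokes equations*,
  arXiv:1908.04958v2 (Proc. Sympos. Pure Math. 104, 2021), Prop. 3.1 (i), (3.2), pp. 8, 10;
  (2.3) p. 8. [Tao2021QuantitativeNS]
* H. Bahouri, J.-Y. Chemin, R. Danchin, *Fourier Analysis and Nonlinear PDE* (2011), Lemma 2.1
  (Bernstein). [BahouriCheminDanchin2011]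
-/

noncomputable section

open MeasureTheory Set Function Filter Topology
open scoped ENNReal NNReal ContDiff

namespace Literature.Analysis.FluidPDE

open FunctionSpaces

section Bernstein

variable {ι : Type*} [Fintype ι]
variable {E : Type*} [NormedAddCommGroup E] [InnerProductSpace ℝ E] [FiniteDimensional ℝ E]
  [MeasurableSpace E] [BorelSpace E]

/-- **Bernstein for derivatives of blocks of real fields at `L^∞`** (BCD Lemma 2.1, direct
part, `p = ∞`; tree: `FunctionSpaces.exists_eLpNormDistrib_lineDeriv_lpBlock_le`): there is `C`
with `‖∂_m Δ̇_j v‖_{L^∞} ≤ C 2^j ‖m‖ ‖Δ̇_j v‖_{L^∞}` for every direction `m`, every `j` and every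
`C¹ ∩ L²` field `v` with `v`, `Dv` bounded. [cite: BahouriCheminDanchin2011, Lemma 2.1] -/
theorem exists_eLpNorm_top_fderiv_blockFn_le :
    ∃ C : ℝ≥0, ∀ (m : E) (j : ℤ) (v : E → EuclideanSpace ℝ ι), IsC1L2Field v →
      eLpNorm (fun x => fderiv ℝ (blockFn j v) x m) ∞ volume ≤
        C * ENNReal.ofReal ((2 : ℝ) ^ j * ‖m‖) * eLpNorm (blockFn j v) ∞ volume := by
  haveI : Fact (1 ≤ (∞ : ℝ≥0∞)) := ⟨le_top⟩
  obtain ⟨C, hC⟩ := FunctionSpaces.exists_eLpNormDistrib_lineDeriv_lpBlock_le (E := E)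
    (F := EuclideanSpace ℂ ι) ∞
  refine ⟨C, fun m j v h => ?_⟩
  obtain ⟨M₀, hM₀⟩ := h.bounded
  obtain ⟨M₁, hM₁⟩ := h.bounded_fderiv
  have hV : IsDistributionOf v _ := isDistributionOf_toTemperedDistribution h.memLp
  have htop : MemLp (fun x => fderiv ℝ (blockFn j v) x m) ∞ volume := by
    rw [h.fderiv_blockFn_apply j m]
    exact memLp_top_blockFn j (h.memLp_fderiv m)
  have h1 := hC m j (((memLp_complexify_comp h.memLp).toLp _ :
    Lp (EuclideanSpace ℂ ι) 2 (volume : Measure E)) : TemperedDistribution E (EuclideanSpace ℂ ι))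
  rwa [(hV.fderiv_blockFn h.contDiff h.memLp hM₀ hM₁ m (h.memLp_fderiv m) j).eLpNormDistrib_eq
    htop, hV.eLpNormDistrib_top_lpBlock_eq h.memLp] at h1

end Bernstein

section DimThree

/-- **Tao 2021, (3.2), first two claims, for fields.** There is an absolute `C` such that for
every `C¹ ∩ L²` field `v : ℝ³ → ℝ³` with bounded derivative, `v ∈ L³`, `‖v‖₃ ≤ A`, every
dyadic `j` (`N = 2^j`) and direction `m`:
`‖Δ̇_j v‖_{L^∞} ≤ C 2^j A` (Bernstein `L³ → L^∞`: the factor is `2^{3j/3} = N`) and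
`‖∂_m Δ̇_j v‖_{L^∞} ≤ C (2^j ‖m‖) 2^j A` (`= O(‖m‖ A N²)`). [cite: Tao2021QuantitativeNS, (3.2) p. 8 and p. 10] -/
theorem exists_tao_blockFn_bounds :
    ∃ C : ℝ≥0, ∀ (v : EuclideanSpace ℝ (Fin 3) → EuclideanSpace ℝ (Fin 3)) (A : ℝ) (j : ℤ)
      (m : EuclideanSpace ℝ (Fin 3)), IsC1L2Field v → MemLp v 3 volume →
      eLpNorm v 3 volume ≤ ENNReal.ofReal A →
      eLpNorm (blockFn j v) ∞ volume ≤ C * (2 : ℝ≥0∞) ^ (j : ℝ) * ENNReal.ofReal A ∧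
      eLpNorm (fun x => fderiv ℝ (blockFn j v) x m) ∞ volume ≤
        C * ENNReal.ofReal ((2 : ℝ) ^ j * ‖m‖) * ((2 : ℝ≥0∞) ^ (j : ℝ) * ENNReal.ofReal A) := by
  haveI : Fact (1 ≤ (3 : ℝ≥0∞)) := ⟨by norm_num⟩
  obtain ⟨CB, hCB⟩ := exists_eLpNorm_top_blockFn_le_eLpNorm (E := EuclideanSpace ℝ (Fin 3))
    (ι := Fin 3) 3
  obtain ⟨CD, hCD⟩ := exists_eLpNorm_top_fderiv_blockFn_le (E := EuclideanSpace ℝ (Fin 3))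
    (ι := Fin 3)
  refine ⟨max CB (CD * CB), fun v A j m hv hv3 hA => ?_⟩
  have hexp : (j : ℝ) * Module.finrank ℝ (EuclideanSpace ℝ (Fin 3)) * (3 : ℝ≥0∞).toReal⁻¹ = j := by
    rw [finrank_euclideanSpace_fin, ENNReal.toReal_ofNat]; push_cast; ring
  have h1 : eLpNorm (blockFn j v) ∞ volume ≤ CB * (2 : ℝ≥0∞) ^ (j : ℝ) * ENNReal.ofReal A := by
    have := hCB j hv3
    rw [hexp] at this
    exact this.trans (by gcongr)
  refine ⟨h1.trans (by gcongr; exact_mod_cast le_max_left CB (CD * CB)), ?_⟩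
  calc eLpNorm (fun x => fderiv ℝ (blockFn j v) x m) ∞ volume
      ≤ CD * ENNReal.ofReal ((2 : ℝ) ^ j * ‖m‖) * eLpNorm (blockFn j v) ∞ volume := hCD m j v hv
    _ ≤ CD * ENNReal.ofReal ((2 : ℝ) ^ j * ‖m‖) * (CB * (2 : ℝ≥0∞) ^ (j : ℝ) * ENNReal.ofReal A) := by
        gcongr
    _ = ((CD * CB : ℝ≥0) : ℝ≥0∞) * ENNReal.ofReal ((2 : ℝ) ^ j * ‖m‖) *
          ((2 : ℝ≥0∞) ^ (j : ℝ) * ENNReal.ofReal A) := by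
        push_cast; ring
    _ ≤ _ := by gcongr; exact_mod_cast le_max_right CB (CD * CB)

/-- **Slices of Tao-class solutions are `C¹ ∩ L²` fields with bounded derivative** (they are
smooth with all derivatives in `L²`, `isSmoothL2Field_of_sobolev`). [folklore] -/
theorem IsTaoSolutionOn.isC1L2Field_slice {T : ℝ}
    {u₀ : EuclideanSpace ℝ (Fin 3) → EuclideanSpace ℝ (Fin 3)}
    {u : ℝ → EuclideanSpace ℝ (Fin 3) → EuclideanSpace ℝ (Fin 3)}
    {q : ℝ → EuclideanSpace ℝ (Fin 3) → ℝ} (h : IsTaoSolutionOn T 1 u₀ u q) {t : ℝ}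
    (ht : t ∈ Icc 0 T) : IsC1L2Field (u t) := by
  obtain ⟨h1, -, h3⟩ := h.slice ht
  exact IsC1L2Field.of_isSmoothL2Field (isSmoothL2Field_of_sobolev h1 h3)

/-- **Tao 2021, Prop. 3.1 (i), (3.2), first two claims, for Tao-class solutions.** There is an
absolute `C` such that: if `(u, q)` is a Tao-class solution on `[0, T]` with
`‖u(t)‖_{L³} ≤ A` for all `t ∈ [0, T]`, then for every `t ∈ [0, T]`, dyadic `j` (`N = 2^j`)
and direction `m`, `‖Δ̇_j u(t)‖_{L^∞} ≤ C 2^j A` and `‖∂_m Δ̇_j u(t)‖_{L^∞} ≤ C (2^j‖m‖) 2^j A`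
("immediate from (3.1) and (2.3)"). [cite: Tao2021QuantitativeNS, Prop. 3.1 (i) (3.2) p. 8] -/
theorem IsTaoSolutionOn.blockFn_bounds :
    ∃ C : ℝ≥0, ∀ ⦃T : ℝ⦄ ⦃u₀ : EuclideanSpace ℝ (Fin 3) → EuclideanSpace ℝ (Fin 3)⦄
      ⦃u : ℝ → EuclideanSpace ℝ (Fin 3) → EuclideanSpace ℝ (Fin 3)⦄
      ⦃q : ℝ → EuclideanSpace ℝ (Fin 3) → ℝ⦄, IsTaoSolutionOn T 1 u₀ u q →
      ∀ ⦃A : ℝ⦄, (∀ t ∈ Icc 0 T, eLpNorm (u t) 3 volume ≤ ENNReal.ofReal A) →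
      ∀ t ∈ Icc 0 T, ∀ (j : ℤ) (m : EuclideanSpace ℝ (Fin 3)),
        eLpNorm (blockFn j (u t)) ∞ volume ≤ C * (2 : ℝ≥0∞) ^ (j : ℝ) * ENNReal.ofReal A ∧
        eLpNorm (fun x => fderiv ℝ (blockFn j (u t)) x m) ∞ volume ≤
          C * ENNReal.ofReal ((2 : ℝ) ^ j * ‖m‖) * ((2 : ℝ≥0∞) ^ (j : ℝ) * ENNReal.ofReal A) := by
  obtain ⟨C, hC⟩ := exists_tao_blockFn_bounds
  exact ⟨C, fun T u₀ u q h A hA t ht j m =>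
    hC (u t) A j m (h.isC1L2Field_slice ht) (h.continuousInLpOn_three.1 t ht) (hA t ht)⟩

end DimThree

end Literature.Analysis.FluidPDE
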